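import Literature.MathematicalPhysics.QuantumFieldTheory.Balaban1983to89.B2Eq28RegionsConcrete

/-!
# `Balaban1983to89.B2Eq255RegionsWindow` — T. Bałaban, *(Higgs)₂,₃ quantum fields in a finite volume. II. An upper bound*,
Commun. Math. Phys. **86** (1982) 555–594 [Balaban1982Higgs2] p. 570 (the paragraph between (2.55) and (2.56)) and p. 566
(«admissible»): **the step-`(k+1)` small-field regions `Λ₀^{(k)} ⊃ Λ₁^{(k)} ⊃ …` CONSTRUCTED INSIDE THE WINDOW `Λ₇^{(k−1)′}`
on the concrete (Higgs)₂,₃ torus** `…HiggsLattice.Site P k` — the general-step form of the construction (2.7)–(2.8) whose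
first-step form (window = the whole lattice `T₁`) is the typer's `…B2Eq28RegionsConcrete.region` — with the printed
consequences PROVED: every `Λ_i^{(k)}` is a union of large blocks contained in the window, the regions are nested and
separated, the large fields and the complement of the window are at distance `> r` from `Λ₁^{(k)}`, and the general-level
«admissibility» clause of p. 566 holds

statement-level skeleton of published theorems with citation tags; proofs where landed; nothing here is a claim about the Yang–Mills mass gap

PDF held: `paper:balaban1982-cmp86-higgs23-ii` (journal page = PDF page + 554); p. 570 [PDF 16] and p. 566 [PDF 12] READ AS
IMAGES on the ×2 renders `run/shared/lean/pub/pub-balaban/b2b-balaban-ref1/pages/1982-cmp86-higgs23-II/1982-cmp86-higgs23-II-p016-x2.png`,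
`…-p012-x2.png`; p. 558 [PDF 4] for (2.7)–(2.8).

CITATION HEADER (lean-in-tree rule).  lit-balaban typed skeleton (HOME `run/shared/lean/pub/lit-balaban/`), typer line
(concrete carriers), gen 9.  SKELETON rows served: **B2.Eq2.55** ((2.53)–(2.56) p. 569–570, fold owner r02: the region
letters `Λ_i^{(k)}` of the `(k+1)`-st step — this file is the p. 570 DEFINITION of `Λ₀^{(k)}` relative to `Λ₇^{(k−1)′}` made
concrete), **B2.Eq2.43** (the «admissible» clause of p. 566 at a general level), **B2.Eq2.7** ((2.7)–(2.8): the first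
step is the instance `W = T₁`, `regionRel_univ`).  NOTHING of record is restated or redefined: the step (2.8) IS r14's
`…B2LargeField.lambdaSuccCompl` at the gen-8 distance `lbDist₂`, the zeroth complement of (2.7) IS gen-8's
`regionCompl bad r 0` (= r14's `lambda0Compl lbDist bad r`), the large blocks ARE `HiggsRescaling.largeBlockOf/largeBlock/
IsUnionOfLargeBlocks` (part I p. 607), distances ARE (I.1.3) `HiggsLattice.Site.tdist`; the gen-8 lemmas (`sep_bad`,
`not_bad_of_mem_near_region`, `tdist_le_lbDist₂_add`, `regionCompl_largeBlockOf_congr`, …) are USED, not re-proved.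

THE SOURCE TEXT, p. 570 [PDF 16], verbatim.  *"Now we introduce the new restrictions on the fields B, ψ, A, φ considered on
the set Λ₇^{(k−1)′}. The restrictions are identical to these considered in the first step, Sect. A, and are given by
(2.4)–(2.6), with the replacements of ε by Lᵏε, T₁ by Λ₇^{(k−1)′} and the field A by Ā^{(k)} in the expressions for scalar
fields. We will not rewrite these definitions, except the definition of Λ₀^{(k)}: Λ₀^{(k)} is the sum of large blocks of
the lattice T₁^{(k)} contained in Λ₇^{(k−1)′}, distant from the set B(P_v^{(k)})∪Q_v^{(k)}∪R_v^{(k)}∪B(P_s^{(k)})∪Q_s^{(k)}∪R_s^{(k)}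
more than r(Lᵏε). Replacing Λ_i by Λ_i^{(k)}, we have the identities (2.9), (2.10) also."*  p. 566 [PDF 12], verbatim:
*"Here the word “admissible” means that the sets Λ₀^{(j)} have to satisfy all the conditions resulting from the construction.
The sets are unions of big blocks, the set Λ₀^{(0)c} is either empty or has at least one point whose distance from Λ₀^{(0)}
is bigger than r(ε). In general Λ₀^{(j+1)} ⊂ Λ₇^{(j)′}, and either Λ₀^{(j+1)} is a maximal set composed of big blocks and
satisfying this inclusion, or the set Λ₀^{(j+1)c} ∩ Λ₇^{(j)′} has at least one point whose distance from Λ₀^{(j+1)} is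
bigger than r(L^{j+1}ε), and so on. Of course the sets Λ_i^{(j)} are defined in the same way as Λ_i, r(ε) is replaced by
r(Lʲε) only."*  p. 558 [PDF 4] (2.8): *"Λ_{i+1}ᶜ is the sum of all large blocks of T₁ with distances from the set Λ_iᶜ less
or equal r(ε)."*

DICTIONARY (print ↦ Lean).  `T₁^{(k)}` ↦ the torus `HiggsLattice.Site P k`; the WINDOW `Λ₇^{(k−1)′} ⊂ T₁^{(k)}` ↦ an
arbitrary finite set `W : Finset (Site P k)` (the multi-level tower feeding `W = (Λ₇^{(k−1)})′` is the business of the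
sequel file `B2Eq243RegionsTower`); *"the sum of large blocks of T₁^{(k)} contained in Λ₇^{(k−1)′}"* = *"a maximal set
composed of big blocks and satisfying this inclusion"* ↦ `inLB W` (the sites whose large block lies in `W`); *"distant from
the set … more than r(Lᵏε)"* ↦ gen-8's reading of (2.7) (`∀ z bad, r ≤ lbDist x z`, i.e. the complement is *"less than r"*,
see HONEST SCOPE (b)); the large-field points `B(P_v^{(k)}) ∪ … ∪ R_s^{(k)}` ↦ `bad : Set (Site P k)` (data, as in gen 8;
`B2Eq28RegionsConcrete.badSites` assembles it from the six printed sets); `r` ↦ `r(Lᵏε)` in lattice units of `T₁^{(k)}`;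
`Λ₀^{(k)c}` ↦ the SEED complement `relSeed W bad r` = {large block not inside `W`} ∪ {large block at distance `< r` from a
bad point}; `Λ_i^{(k)c}` ↦ `regionRelCompl W bad r i` = (2.8) iterated `i` times from the seed (`grow`); `Λ_i^{(k)}` ↦ the
`Finset` `regionRel W bad r i`.

WHAT THIS FILE PROVES (0 sorry; standard axioms; definitions with bodies + theorems; no `Prop`-valued definition).
§1 `inLB W`: `mem_inLB`, `inLB_subset` (`⊆ W`), `inLB_isUnionOfLargeBlocks`, **`inLB_maximal`** (every union of large blocks
   contained in `W` lies in `inLB W` — the *"maximal set composed of big blocks"* of p. 566), `inLB_univ`.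
§2 `grow S₀ r i` = (2.8) iterated from an arbitrary seed complement `S₀` (r14's `lambdaSuccCompl` at `lbDist₂`):
   `regionCompl_eq_grow` (gen-8's `Λ_iᶜ` is the case `S₀ = Λ₀ᶜ` of (2.7)), `grow_mono`/`grow_mono_of_le` (complements increase,
   `r ≥ 0`), `grow_mono_seed`, `grow_largeBlockOf_congr` (unions of large blocks stay unions of large blocks), **`grow_far`**
   (the (2.8) separation `r < dist(large blocks)` between `Λ_j` and `Λ_iᶜ`, `i < j`), **`exists_seed_near_of_mem_grow`**
   (thickness: every point of the `i`-th complement is within `i·(r + 2(LM − 1))` of the seed).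
§3 the relative regions of p. 570: `mem_regionRel_zero` (**`x ∈ Λ₀^{(k)}` iff the large block of `x` lies in the window
   and is at distance `≥ r` from every bad point** — the printed definition), `regionRel_zero_eq` (`Λ₀^{(k)} = inLB W ∩ Λ₀`),
   **`regionRel_univ`** (window `= T₁`: the relative regions ARE gen-8's `region`, every `i`), `regionRel_isUnionOfLargeBlocks`
   / `regionRel_blockOf_congr` (p15's `Tower.isUnion` shape), `regionRel_succ_subset`/`regionRel_antitone` (nested),
   **`regionRel_subset_inLB`**/**`regionRel_subset_window`** (*"In general Λ₀^{(j+1)} ⊂ Λ₇^{(j)′}"*, every `i`),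
   `regionRel_subset_region` (inside the first-step regions of the same data), **`sep_regionRel`** (`x ∈ Λ_j`, `y ∉ Λ_i`,
   `i < j` ⇒ `r < |x − y|`), `lt_distC_regionRel`, **`sep_window`** (`Λ_{i+1}^{(k)}` is at distance `> r` from the
   complement of the window), `sep_bad_rel` (`≥ r` from the large fields), `not_mem_regionRel_of_bad`,
   `not_mem_regionRel_of_not_subset`, `not_bad_of_mem_near_regionRel` (p. 558 sentence), `exists_seed_near_of_not_mem_regionRel`
   (thickness), `regionRel_eq_univ` (no bad point and `W = T₁` ⇒ `Λ_i = T₁`).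
§4 p. 566 admissibility at a general level, PROVED for the construction: `regionRel_zero_eq_inLB_of_far`,
   **`admissible_rel`** (bad points inside the window, `r > 0` ⇒ `Λ₀^{(k)} = inLB W`, or a point of `Λ₀^{(k)c} ∩ W` is at
   distance `≥ r` from every point of `Λ₀^{(k)}`), `admissible_rel_distC`.
HONEST SCOPE.  (a) As in gen 8, WHICH points are bad is data (the characteristic functions (2.4)–(2.6) *"with the
replacements"* decide it; `B2Eq22LargeFieldSets` reads them off a configuration).  (b) p. 558 (2.7) puts into `Λ₀ᶜ` the
large blocks at distance *"less than r(ε)"* from the large fields, p. 570 puts into `Λ₀^{(k)}` those *"distant … more than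
r(Lᵏε)"*: the two wordings differ on the boundary case `dist = r` only; this file keeps gen-8's (2.7) reading (`Λ₀^{(k)}` =
distance `≥ r`), so that `regionRel_univ` holds literally — the printed *"bigger than r"* of the admissibility clause is
accordingly delivered as `≥ r`, exactly as in gen-8's `admissible_zero`.  (c) One window at a time: the recursion
`W^{(k)} = (Λ₇^{(k−1)})′` over the levels and p15's `B2Eq324NestedRegions.Tower` are the sequel's.  (d) No field, no measure,
no estimate: value = the printed region geometry of the general step made concrete, its hypotheses-by-name for the
(2.57)/(3.22) files; NOT summit progress.  Unit `lit-balaban-typer` gen 9 (literature-prover-lit-balaban-typer-g9-0);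
HOME/FILED.md records the proposal.
-/

open scoped BigOperators

namespace Literature.MathematicalPhysics.QuantumFieldTheory.Balaban1983to89.B2Eq255RegionsWindow

open HiggsLattice HiggsRescaling B2LargeField B2Eq28RegionsConcrete
open B1Ineq234Concrete (distC tdist_self)
open B1Ineq234LevelZero (tdist_comm tdist_triangle_real)

variable {P : HiggsLattice.Params} {k : ℕ}

/-! ## §1 *"the sum of large blocks of the lattice T₁^{(k)} contained in Λ₇^{(k−1)′}"* — the maximal union of large blocks inside a window -/

section InLB

/-- **The maximal union of large blocks contained in `W`**: the sites of `T^{(k)}` whose large block (side `LM`, part I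
p. 607) lies in `W` (p. 566: *"a maximal set composed of big blocks and satisfying this inclusion"* `⊂ Λ₇^{(j)′}`).
[cite: Balaban1982Higgs2, (2.43) p.566] -/
def inLB (W : Finset (HiggsLattice.Site P k)) : Finset (HiggsLattice.Site P k) :=
  Finset.univ.filter fun x => largeBlock (largeBlockOf x) ⊆ W

variable {W : Finset (HiggsLattice.Site P k)}

/-- Membership: `x ∈ inLB W` iff the large block of `x` lies in `W`. [cite: Balaban1982Higgs2, (2.43) p.566] -/
theorem mem_inLB {x : HiggsLattice.Site P k} : x ∈ inLB W ↔ largeBlock (largeBlockOf x) ⊆ W := by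
  unfold inLB
  simp only [Finset.mem_filter, Finset.mem_univ, true_and]

/-- `inLB W ⊆ W` (a site lies in its own large block). [cite: Balaban1982Higgs2, (2.43) p.566] -/
theorem inLB_subset (W : Finset (HiggsLattice.Site P k)) : inLB W ⊆ W := fun x hx =>
  (mem_inLB.mp hx) (mem_largeBlock_self x)

/-- Membership in `inLB W` depends only on the large block. [cite: Balaban1982Higgs2, (2.43) p.566] -/
theorem inLB_largeBlockOf_congr {x x' : HiggsLattice.Site P k} (h : largeBlockOf x = largeBlockOf x') :
    x ∈ inLB W ↔ x' ∈ inLB W := by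
  rw [mem_inLB, mem_inLB, h]

/-- `inLB W` is a union of large blocks (*"composed of big blocks"*). [cite: Balaban1982Higgs2, (2.43) p.566] -/
theorem inLB_isUnionOfLargeBlocks (W : Finset (HiggsLattice.Site P k)) : IsUnionOfLargeBlocks (inLB W) := by
  rw [isUnionOfLargeBlocks_iff]
  intro x x' h
  exact inLB_largeBlockOf_congr h

/-- **Maximality**: every union of large blocks contained in `W` is contained in `inLB W` (p. 566: *"a maximal set composed
of big blocks and satisfying this inclusion"*). [cite: Balaban1982Higgs2, (2.43) p.566] -/
theorem inLB_maximal {Ω : Finset (HiggsLattice.Site P k)} (hΩ : IsUnionOfLargeBlocks Ω) (hΩW : Ω ⊆ W) : Ω ⊆ inLB W := by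
  intro x hx
  rw [mem_inLB]
  intro x' hx'
  exact hΩW (hΩ x hx x' (mem_largeBlock.mp hx'))

/-- With the whole lattice as window (the first step, `T₁`), `inLB T₁ = T₁`. [cite: Balaban1982Higgs2, (2.7) p.558] -/
theorem inLB_univ : inLB (Finset.univ : Finset (HiggsLattice.Site P k)) = Finset.univ := by
  ext x
  simp only [Finset.mem_univ, mem_inLB, Finset.subset_univ]

end InLB

/-! ## §2 (2.8) iterated from an arbitrary seed complement -/

section Grow

/-- **(2.8) iterated `i` times from a seed complement `S₀`**: `grow S₀ r 0 = S₀`, `grow S₀ r (i+1)` = the large blocks at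
distance `≤ r` from `grow S₀ r i` (r14's `B2LargeField.lambdaSuccCompl` at the gen-8 distance `lbDist₂` between large
blocks). With `S₀ = Λ₀ᶜ` of (2.7) this is `Λ_iᶜ`; with the p. 570 seed it is `Λ_i^{(k)c}`. [cite: Balaban1982Higgs2, (2.8) p.558] -/
def grow (S₀ : Set (HiggsLattice.Site P k)) (r : ℝ) : ℕ → Set (HiggsLattice.Site P k)
  | 0 => S₀
  | i + 1 => lambdaSuccCompl lbDist₂ r (grow S₀ r i)

variable {S₀ S₁ : Set (HiggsLattice.Site P k)} {r : ℝ}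

/-- `grow S₀ r 0 = S₀`. [cite: Balaban1982Higgs2, (2.8) p.558] -/
theorem grow_zero (S₀ : Set (HiggsLattice.Site P k)) (r : ℝ) : grow S₀ r 0 = S₀ := rfl

/-- The step: `grow S₀ r (i+1)` is (2.8) applied to `grow S₀ r i`. [cite: Balaban1982Higgs2, (2.8) p.558] -/
theorem grow_succ (S₀ : Set (HiggsLattice.Site P k)) (r : ℝ) (i : ℕ) :
    grow S₀ r (i + 1) = lambdaSuccCompl lbDist₂ r (grow S₀ r i) := rfl

/-- (2.8) unfolded: `x ∈ grow S₀ r (i+1)` iff the large block of `x` is at distance `≤ r` from (the large block of) a point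
of `grow S₀ r i`. [cite: Balaban1982Higgs2, (2.8) p.558] -/
theorem mem_grow_succ {i : ℕ} {x : HiggsLattice.Site P k} :
    x ∈ grow S₀ r (i + 1) ↔ ∃ y ∈ grow S₀ r i, lbDist₂ x y ≤ r := Iff.rfl

/-- **gen-8's `Λ_iᶜ` of (2.7)–(2.8) is (2.8) iterated from `Λ₀ᶜ`.** [cite: Balaban1982Higgs2, (2.8) p.558] -/
theorem regionCompl_eq_grow (bad : Set (HiggsLattice.Site P k)) (r : ℝ) :
    ∀ i : ℕ, regionCompl bad r i = grow (regionCompl bad r 0) r i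
  | 0 => rfl
  | i + 1 => by rw [grow_succ, ← regionCompl_eq_grow bad r i]; rfl

/-- The complements increase, `grow i ⊆ grow (i+1)` (`r ≥ 0`: a large block is at distance `0 ≤ r` from itself).
[cite: Balaban1982Higgs2, (2.8) p.558] -/
theorem grow_mono (hr : 0 ≤ r) (i : ℕ) : grow S₀ r i ⊆ grow S₀ r (i + 1) := fun x hx =>
  ⟨x, hx, by rw [lbDist₂_self]; exact hr⟩

/-- `grow i ⊆ grow j` for `i ≤ j`. [cite: Balaban1982Higgs2, (2.8) p.558] -/
theorem grow_mono_of_le (hr : 0 ≤ r) {i j : ℕ} (hij : i ≤ j) : grow S₀ r i ⊆ grow S₀ r j := by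
  induction hij with
  | refl => exact le_rfl
  | step _ ih => exact ih.trans (grow_mono hr _)

/-- The seed lies in every iterate (`r ≥ 0`). [cite: Balaban1982Higgs2, (2.8) p.558] -/
theorem seed_subset_grow (hr : 0 ≤ r) (i : ℕ) : S₀ ⊆ grow S₀ r i :=
  grow_mono_of_le hr (Nat.zero_le i)

/-- The iteration is monotone in the seed. [cite: Balaban1982Higgs2, (2.8) p.558] -/
theorem grow_mono_seed (h : S₀ ⊆ S₁) (r : ℝ) : ∀ i : ℕ, grow S₀ r i ⊆ grow S₁ r i
  | 0 => h
  | i + 1 => fun x hx => by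
      obtain ⟨y, hy, hd⟩ := mem_grow_succ.mp hx
      exact ⟨y, grow_mono_seed h r i hy, hd⟩

/-- **Unions of large blocks stay unions of large blocks** under (2.8): if membership in the seed depends only on the large
block, so does membership in every iterate. [cite: Balaban1982Higgs2, (2.8) p.558] -/
theorem grow_largeBlockOf_congr
    (hS : ∀ x x' : HiggsLattice.Site P k, largeBlockOf x = largeBlockOf x' → (x ∈ S₀ ↔ x' ∈ S₀))
    {x x' : HiggsLattice.Site P k} (h : largeBlockOf x = largeBlockOf x') :
    ∀ i : ℕ, x ∈ grow S₀ r i ↔ x' ∈ grow S₀ r i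
  | 0 => hS x x' h
  | i + 1 => by
      rw [mem_grow_succ, mem_grow_succ]
      simp_rw [lbDist₂_congr_left h]

/-- **The (2.8) separation along the iteration**: a large block NOT in the `j`-th complement is at distance `> r` from every
large block of the `i`-th complement, `i < j` (the `i`-th complement lies in the `(j−1)`-st, and the `j`-th collects everything
within `≤ r` of the `(j−1)`-st). [cite: Balaban1982Higgs2, (2.8) p.558] -/
theorem grow_far (hr : 0 ≤ r) {i j : ℕ} (hij : i < j) {x y : HiggsLattice.Site P k} (hx : x ∉ grow S₀ r j)
    (hy : y ∈ grow S₀ r i) : r < lbDist₂ x y := by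
  obtain ⟨j', rfl⟩ := Nat.exists_eq_add_of_lt hij
  have hy' : y ∈ grow S₀ r (i + j') := grow_mono_of_le hr (Nat.le_add_right i j') hy
  by_contra hle
  exact hx (mem_grow_succ.mpr ⟨y, hy', not_lt.mp hle⟩)

/-- **Thickness**: every point of the `i`-th complement is within distance `i · (r + 2(LM − 1))` of a point of the seed
(each application of (2.8) moves by `≤ r` between large blocks, i.e. by `≤ r + 2(LM − 1)` between points, gen-8's
`tdist_le_lbDist₂_add`). [cite: Balaban1982Higgs2, (2.8) p.558] -/
theorem exists_seed_near_of_mem_grow :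
    ∀ (i : ℕ) {x : HiggsLattice.Site P k}, x ∈ grow S₀ r i →
      ∃ y ∈ S₀, (HiggsLattice.Site.tdist x y : ℝ) ≤ (i : ℝ) * (r + 2 * ((P.L : ℝ) * P.M - 1))
  | 0, x, hx => ⟨x, hx, by rw [tdist_self]; simp⟩
  | i + 1, x, hx => by
      obtain ⟨y, hy, hxy⟩ := mem_grow_succ.mp hx
      obtain ⟨z, hz, hyz⟩ := exists_seed_near_of_mem_grow i hy
      refine ⟨z, hz, ?_⟩
      calc (HiggsLattice.Site.tdist x z : ℝ) ≤ (HiggsLattice.Site.tdist x y : ℝ) + (HiggsLattice.Site.tdist y z : ℝ) :=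
            tdist_triangle_real x y z
        _ ≤ (lbDist₂ x y + 2 * ((P.L : ℝ) * P.M - 1)) + (i : ℝ) * (r + 2 * ((P.L : ℝ) * P.M - 1)) :=
            add_le_add (tdist_le_lbDist₂_add x y) hyz
        _ ≤ (r + 2 * ((P.L : ℝ) * P.M - 1)) + (i : ℝ) * (r + 2 * ((P.L : ℝ) * P.M - 1)) := by linarith
        _ = ((i + 1 : ℕ) : ℝ) * (r + 2 * ((P.L : ℝ) * P.M - 1)) := by push_cast; ring

end Grow

/-! ## §3 p. 570: the regions `Λ_i^{(k)}` inside the window `Λ₇^{(k−1)′}` -/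

section Rel

/-- **The seed complement `Λ₀^{(k)c}` of p. 570**: the large blocks of `T₁^{(k)}` NOT contained in the window `W`
(= `Λ₇^{(k−1)′}`), together with those at distance `< r` from a large-field point (gen-8's `regionCompl bad r 0`, the
(2.7) complement). [cite: Balaban1982Higgs2, (2.55) p.570] -/
def relSeed (W : Finset (HiggsLattice.Site P k)) (bad : Set (HiggsLattice.Site P k)) (r : ℝ) : Set (HiggsLattice.Site P k) :=
  {x | ¬ largeBlock (largeBlockOf x) ⊆ W ∨ x ∈ regionCompl bad r 0}

/-- **`Λ_i^{(k)c}`**: (2.8) iterated from the p. 570 seed (*"Replacing Λ_i by Λ_i^{(k)}, we have the identities (2.9), (2.10)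
also"* — the same construction). [cite: Balaban1982Higgs2, (2.55) p.570] -/
def regionRelCompl (W : Finset (HiggsLattice.Site P k)) (bad : Set (HiggsLattice.Site P k)) (r : ℝ) (i : ℕ) :
    Set (HiggsLattice.Site P k) :=
  grow (relSeed W bad r) r i

/-- **`Λ_i^{(k)}`** as a finite set of sites of `T₁^{(k)}` (the complement of `regionRelCompl`). [cite: Balaban1982Higgs2, (2.55) p.570] -/
noncomputable def regionRel (W : Finset (HiggsLattice.Site P k)) (bad : Set (HiggsLattice.Site P k)) (r : ℝ) (i : ℕ) :
    Finset (HiggsLattice.Site P k) :=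
  open Classical in Finset.univ.filter fun x => x ∉ regionRelCompl W bad r i

variable {W : Finset (HiggsLattice.Site P k)} {bad : Set (HiggsLattice.Site P k)} {r : ℝ}

/-- `x ∈ Λ_i^{(k)} ↔ x ∉ Λ_i^{(k)c}`. [cite: Balaban1982Higgs2, (2.55) p.570] -/
theorem mem_regionRel {i : ℕ} {x : HiggsLattice.Site P k} : x ∈ regionRel W bad r i ↔ x ∉ regionRelCompl W bad r i := by
  unfold regionRel
  simp only [Finset.mem_filter, Finset.mem_univ, true_and]

/-- `x ∉ Λ_i^{(k)} ↔ x ∈ Λ_i^{(k)c}`. [cite: Balaban1982Higgs2, (2.55) p.570] -/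
theorem not_mem_regionRel {i : ℕ} {x : HiggsLattice.Site P k} : x ∉ regionRel W bad r i ↔ x ∈ regionRelCompl W bad r i := by
  rw [mem_regionRel, not_not]

/-- The `Finset` complement of `Λ_i^{(k)}` is `Λ_i^{(k)c}`. [cite: Balaban1982Higgs2, (2.55) p.570] -/
theorem mem_compl_regionRel {i : ℕ} {x : HiggsLattice.Site P k} :
    x ∈ (regionRel W bad r i)ᶜ ↔ x ∈ regionRelCompl W bad r i := by
  rw [Finset.mem_compl, not_mem_regionRel]

/-- Membership in the seed. [cite: Balaban1982Higgs2, (2.55) p.570] -/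
theorem mem_relSeed {x : HiggsLattice.Site P k} :
    x ∈ relSeed W bad r ↔ ¬ largeBlock (largeBlockOf x) ⊆ W ∨ x ∈ regionCompl bad r 0 := Iff.rfl

/-- `Λ₀^{(k)c}` is the seed, `Λ_{i+1}^{(k)c}` is (2.8) applied to `Λ_i^{(k)c}`. [cite: Balaban1982Higgs2, (2.55) p.570] -/
theorem regionRelCompl_zero : regionRelCompl W bad r 0 = relSeed W bad r := rfl

/-- The step of the construction. [cite: Balaban1982Higgs2, (2.55) p.570] -/
theorem regionRelCompl_succ (i : ℕ) :
    regionRelCompl W bad r (i + 1) = lambdaSuccCompl lbDist₂ r (regionRelCompl W bad r i) := rfl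

/-- (2.8) unfolded for the relative regions. [cite: Balaban1982Higgs2, (2.55) p.570] -/
theorem mem_regionRelCompl_succ {i : ℕ} {x : HiggsLattice.Site P k} :
    x ∈ regionRelCompl W bad r (i + 1) ↔ ∃ y ∈ regionRelCompl W bad r i, lbDist₂ x y ≤ r := Iff.rfl

/-- **The printed definition of `Λ₀^{(k)}`, p. 570**: `x ∈ Λ₀^{(k)}` iff the large block of `x` is *"contained in
Λ₇^{(k−1)′}"* and *"distant from the set B(P_v^{(k)})∪…∪R_s^{(k)}"* by `≥ r` (gen-8's reading of the (2.7) threshold).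
[cite: Balaban1982Higgs2, (2.55) p.570] -/
theorem mem_regionRel_zero {x : HiggsLattice.Site P k} :
    x ∈ regionRel W bad r 0 ↔ largeBlock (largeBlockOf x) ⊆ W ∧ ∀ z ∈ bad, r ≤ lbDist x z := by
  rw [mem_regionRel, regionRelCompl_zero, mem_relSeed, not_or, not_not, regionCompl_eq_lambdaCompl]
  exact and_congr Iff.rfl (not_mem_lambda0Compl_iff lbDist bad r x)

/-- `Λ₀^{(k)} = inLB W ∩ Λ₀`: the maximal union of large blocks inside the window, intersected with the first-step region of
the same large-field data. [cite: Balaban1982Higgs2, (2.55) p.570] -/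
theorem regionRel_zero_eq (W : Finset (HiggsLattice.Site P k)) (bad : Set (HiggsLattice.Site P k)) (r : ℝ) :
    regionRel W bad r 0 = inLB W ∩ region bad r 0 := by
  ext x
  rw [Finset.mem_inter, mem_inLB, mem_regionRel, mem_region, regionRelCompl_zero, mem_relSeed, not_or, not_not]

/-- With the whole lattice as window the seed is `Λ₀ᶜ` of (2.7). [cite: Balaban1982Higgs2, (2.7) p.558] -/
theorem relSeed_univ (bad : Set (HiggsLattice.Site P k)) (r : ℝ) :
    relSeed (Finset.univ : Finset (HiggsLattice.Site P k)) bad r = regionCompl bad r 0 := by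
  ext x
  simp only [mem_relSeed, Finset.subset_univ, not_true_eq_false, false_or]

/-- With the whole lattice as window, `Λ_i^{(k)c} = Λ_iᶜ` of (2.7)–(2.8). [cite: Balaban1982Higgs2, (2.8) p.558] -/
theorem regionRelCompl_univ (bad : Set (HiggsLattice.Site P k)) (r : ℝ) (i : ℕ) :
    regionRelCompl (Finset.univ : Finset (HiggsLattice.Site P k)) bad r i = regionCompl bad r i := by
  rw [regionRelCompl, relSeed_univ, ← regionCompl_eq_grow]

/-- **The first step is the instance `W = T₁`**: the relative regions with the whole lattice as window ARE gen-8's regions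
`B2Eq28RegionsConcrete.region` of (2.7)–(2.8), for every `i`. [cite: Balaban1982Higgs2, (2.8) p.558] -/
theorem regionRel_univ (bad : Set (HiggsLattice.Site P k)) (r : ℝ) (i : ℕ) :
    regionRel (Finset.univ : Finset (HiggsLattice.Site P k)) bad r i = region bad r i := by
  ext x
  rw [mem_regionRel, mem_region, regionRelCompl_univ]

/-- Membership in the seed depends only on the large block. [cite: Balaban1982Higgs2, (2.55) p.570] -/
theorem relSeed_largeBlockOf_congr {x x' : HiggsLattice.Site P k} (h : largeBlockOf x = largeBlockOf x') :
    x ∈ relSeed W bad r ↔ x' ∈ relSeed W bad r := by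
  rw [mem_relSeed, mem_relSeed, h, regionCompl_largeBlockOf_congr h 0]

/-- **`Λ_i^{(k)c}` is a sum of large blocks**: membership depends only on the large block. [cite: Balaban1982Higgs2, (2.55) p.570] -/
theorem regionRelCompl_largeBlockOf_congr {x x' : HiggsLattice.Site P k} (h : largeBlockOf x = largeBlockOf x') (i : ℕ) :
    x ∈ regionRelCompl W bad r i ↔ x' ∈ regionRelCompl W bad r i :=
  grow_largeBlockOf_congr (fun _ _ hyy' => relSeed_largeBlockOf_congr hyy') h i

/-- **`Λ_i^{(k)}` is a sum of large blocks** (*"the sum of large blocks of the lattice T₁^{(k)}"*; the typer's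
`HiggsRescaling.IsUnionOfLargeBlocks`). [cite: Balaban1982Higgs2, (2.55) p.570] -/
theorem regionRel_isUnionOfLargeBlocks (W : Finset (HiggsLattice.Site P k)) (bad : Set (HiggsLattice.Site P k)) (r : ℝ) (i : ℕ) :
    IsUnionOfLargeBlocks (regionRel W bad r i) := by
  rw [isUnionOfLargeBlocks_iff]
  intro x x' h
  rw [mem_regionRel, mem_regionRel, regionRelCompl_largeBlockOf_congr h i]

/-- `Λ_i^{(k)c}` (as a `Finset`) is a sum of large blocks. [cite: Balaban1982Higgs2, (2.55) p.570] -/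
theorem compl_regionRel_isUnionOfLargeBlocks (W : Finset (HiggsLattice.Site P k)) (bad : Set (HiggsLattice.Site P k)) (r : ℝ) (i : ℕ) :
    IsUnionOfLargeBlocks (regionRel W bad r i)ᶜ :=
  isUnionOfLargeBlocks_compl (regionRel_isUnionOfLargeBlocks W bad r i)

/-- **`Λ_i^{(k)}` is a union of blocks**, in the shape of p15's `B2Eq324NestedRegions.Tower.isUnion` (*"The sets are unions of
big blocks"*, p. 566). [cite: Balaban1982Higgs2, (2.43) p.566] -/
theorem regionRel_blockOf_congr (W : Finset (HiggsLattice.Site P k)) (bad : Set (HiggsLattice.Site P k)) (r : ℝ) (i : ℕ)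
    {x x' : HiggsLattice.Site P k} (hb : HiggsLattice.blockOf x = HiggsLattice.blockOf x') :
    x ∈ regionRel W bad r i ↔ x' ∈ regionRel W bad r i :=
  isUnionOfLargeBlocks_blockOf_congr (regionRel_isUnionOfLargeBlocks W bad r i) hb

/-- **The relative regions are nested, `Λ_{i+1}^{(k)} ⊆ Λ_i^{(k)}`** (`r ≥ 0`). [cite: Balaban1982Higgs2, (2.55) p.570] -/
theorem regionRel_succ_subset (hr : 0 ≤ r) (i : ℕ) : regionRel W bad r (i + 1) ⊆ regionRel W bad r i := by
  intro x hx
  rw [mem_regionRel] at hx ⊢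
  exact fun h => hx (grow_mono hr i h)

/-- `Λ_j^{(k)} ⊆ Λ_i^{(k)}` for `i ≤ j`. [cite: Balaban1982Higgs2, (2.55) p.570] -/
theorem regionRel_antitone (hr : 0 ≤ r) {i j : ℕ} (hij : i ≤ j) : regionRel W bad r j ⊆ regionRel W bad r i := by
  intro x hx
  rw [mem_regionRel] at hx ⊢
  exact fun h => hx (grow_mono_of_le hr hij h)

/-- A site whose large block is not inside the window lies in every `Λ_i^{(k)c}` (`r ≥ 0`). [cite: Balaban1982Higgs2, (2.55) p.570] -/
theorem not_mem_regionRel_of_not_subset (hr : 0 ≤ r) (i : ℕ) {x : HiggsLattice.Site P k}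
    (hx : ¬ largeBlock (largeBlockOf x) ⊆ W) : x ∉ regionRel W bad r i :=
  not_mem_regionRel.mpr (seed_subset_grow hr i (Or.inl hx))

/-- **`Λ_i^{(k)} ⊆ inLB W`**: every relative region is a union of large blocks CONTAINED IN THE WINDOW (p. 570 *"contained in
Λ₇^{(k−1)′}"*; p. 566 *"In general Λ₀^{(j+1)} ⊂ Λ₇^{(j)′}"*). [cite: Balaban1982Higgs2, (2.43) p.566] -/
theorem regionRel_subset_inLB (hr : 0 ≤ r) (i : ℕ) : regionRel W bad r i ⊆ inLB W := by
  intro x hx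
  rw [mem_inLB]
  by_contra h
  exact not_mem_regionRel_of_not_subset hr i h hx

/-- **`Λ_i^{(k)} ⊆ W`**. [cite: Balaban1982Higgs2, (2.43) p.566] -/
theorem regionRel_subset_window (hr : 0 ≤ r) (i : ℕ) : regionRel W bad r i ⊆ W :=
  (regionRel_subset_inLB hr i).trans (inLB_subset W)

/-- The relative regions lie inside the first-step regions of the same large-field data: `Λ_i^{(k)} ⊆ Λ_i` (the seed
contains `Λ₀ᶜ`, and (2.8) is monotone). [cite: Balaban1982Higgs2, (2.55) p.570] -/
theorem regionRel_subset_region (i : ℕ) : regionRel W bad r i ⊆ region bad r i := by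
  intro x hx
  rw [mem_regionRel] at hx
  rw [mem_region, regionCompl_eq_grow]
  exact fun h => hx (grow_mono_seed (fun y hy => Or.inr hy) r i h)

/-- **(2.8), the separation, AT SITE LEVEL**: a point of `Λ_j^{(k)}` and a point outside `Λ_i^{(k)}`, `i < j`, are at distance
`> r`. [cite: Balaban1982Higgs2, (2.8) p.558] -/
theorem sep_regionRel (hr : 0 ≤ r) {i j : ℕ} (hij : i < j) {x y : HiggsLattice.Site P k} (hx : x ∈ regionRel W bad r j)
    (hy : y ∉ regionRel W bad r i) : r < (HiggsLattice.Site.tdist x y : ℝ) := by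
  rw [mem_regionRel] at hx
  rw [not_mem_regionRel] at hy
  exact (grow_far hr hij hx hy).trans_le (lbDist₂_le_tdist x y)

/-- The one-step case: `x ∈ Λ_{i+1}^{(k)}`, `y ∉ Λ_i^{(k)}` ⇒ `r < |x − y|`. [cite: Balaban1982Higgs2, (2.8) p.558] -/
theorem sep_regionRel_succ (hr : 0 ≤ r) (i : ℕ) {x y : HiggsLattice.Site P k} (hx : x ∈ regionRel W bad r (i + 1))
    (hy : y ∉ regionRel W bad r i) : r < (HiggsLattice.Site.tdist x y : ℝ) :=
  sep_regionRel hr (Nat.lt_succ_self i) hx hy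

/-- Symmetric form (`|x − y| = |y − x|`). [cite: Balaban1982Higgs2, (2.8) p.558] -/
theorem sep_regionRel' (hr : 0 ≤ r) {i j : ℕ} (hij : i < j) {x y : HiggsLattice.Site P k} (hx : x ∈ regionRel W bad r j)
    (hy : y ∉ regionRel W bad r i) : r < (HiggsLattice.Site.tdist y x : ℝ) := by
  rw [tdist_comm]
  exact sep_regionRel hr hij hx hy

/-- **`dist(x, Λ_i^{(k)c}) > r` on `Λ_j^{(k)}`, `i < j`** (r14's `B1Ineq234Concrete.distC`; guard: when `Λ_i^{(k)}` is the whole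
torus `distC = 0` by convention). [cite: Balaban1982Higgs2, (2.8) p.558] -/
theorem lt_distC_regionRel (hr : 0 ≤ r) {i j : ℕ} (hij : i < j) {x : HiggsLattice.Site P k} (hx : x ∈ regionRel W bad r j)
    (hne : ((regionRel W bad r i)ᶜ).Nonempty) : r < distC (regionRel W bad r i) x := by
  unfold distC
  rw [dif_pos hne, Finset.lt_inf'_iff]
  intro y hy
  exact sep_regionRel hr hij hx (Finset.mem_compl.mp hy)

/-- **The window's complement is far from `Λ_{i+1}^{(k)}`**: a point of `Λ_{i+1}^{(k)}` and a point outside `W` are at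
distance `> r` (the latter lies in `Λ₀^{(k)c} ⊆ Λ_i^{(k)c}`). [cite: Balaban1982Higgs2, (2.55) p.570] -/
theorem sep_window (hr : 0 ≤ r) (i : ℕ) {x y : HiggsLattice.Site P k} (hx : x ∈ regionRel W bad r (i + 1)) (hy : y ∉ W) :
    r < (HiggsLattice.Site.tdist x y : ℝ) :=
  sep_regionRel_succ hr i hx fun h => hy (regionRel_subset_window hr i h)

/-- **(2.7), the separation from the large fields**: a point of any `Λ_j^{(k)}` is at distance `≥ r` from every large-field
point (gen-8's `sep_bad` through `Λ_j^{(k)} ⊆ Λ_j`). [cite: Balaban1982Higgs2, (2.7) p.558] -/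
theorem sep_bad_rel (hr : 0 ≤ r) (j : ℕ) {x z : HiggsLattice.Site P k} (hx : x ∈ regionRel W bad r j) (hz : z ∈ bad) :
    r ≤ (HiggsLattice.Site.tdist x z : ℝ) :=
  sep_bad hr j (regionRel_subset_region j hx) hz

/-- Symmetric form of `sep_bad_rel`. [cite: Balaban1982Higgs2, (2.7) p.558] -/
theorem sep_bad_rel' (hr : 0 ≤ r) (j : ℕ) {x z : HiggsLattice.Site P k} (hx : x ∈ regionRel W bad r j) (hz : z ∈ bad) :
    r ≤ (HiggsLattice.Site.tdist z x : ℝ) := by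
  rw [tdist_comm]
  exact sep_bad_rel hr j hx hz

/-- The large-field points lie outside every `Λ_j^{(k)}` (`r > 0`). [cite: Balaban1982Higgs2, (2.7) p.558] -/
theorem not_mem_regionRel_of_bad (hr : 0 < r) (j : ℕ) {z : HiggsLattice.Site P k} (hz : z ∈ bad) : z ∉ regionRel W bad r j :=
  fun h => not_mem_region_of_bad hr j hz (regionRel_subset_region j h)

/-- **p. 558/570: «all the fields are small on the set Λ₀ and on the neighbourhood of Λ₀ of the additional thickness r(ε)»**
for the relative regions: no large-field point lies within distance `< r` of `Λ_j^{(k)}`. [cite: Balaban1982Higgs2, (2.8) p.558] -/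
theorem not_bad_of_mem_near_regionRel (hr : 0 ≤ r) (j : ℕ) {y : HiggsLattice.Site P k}
    (hy : y ∈ near (regionRel W bad r j) r) : y ∉ bad :=
  not_bad_of_mem_near_region hr j (near_mono (regionRel_subset_region j) hy)

/-- **Thickness of `Λ_i^{(k)c}`**: a point outside `Λ_i^{(k)}` is within distance `i · (r + 2(LM − 1))` of the seed `Λ₀^{(k)c}`
(a large block outside the window or near a large field). [cite: Balaban1982Higgs2, (2.8) p.558] -/
theorem exists_seed_near_of_not_mem_regionRel (i : ℕ) {x : HiggsLattice.Site P k} (hx : x ∉ regionRel W bad r i) :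
    ∃ y ∈ relSeed W bad r, (HiggsLattice.Site.tdist x y : ℝ) ≤ (i : ℝ) * (r + 2 * ((P.L : ℝ) * P.M - 1)) :=
  exists_seed_near_of_mem_grow i (not_mem_regionRel.mp hx)

/-- Conversely: if every point within distance `i · (r + 2(LM − 1))` of `x` has its large block inside the window and at
distance `≥ r` from the large fields, then `x ∈ Λ_i^{(k)}`. [cite: Balaban1982Higgs2, (2.8) p.558] -/
theorem mem_regionRel_of_far (i : ℕ) {x : HiggsLattice.Site P k}
    (h : ∀ y : HiggsLattice.Site P k, (HiggsLattice.Site.tdist x y : ℝ) ≤ (i : ℝ) * (r + 2 * ((P.L : ℝ) * P.M - 1)) →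
      largeBlock (largeBlockOf y) ⊆ W ∧ ∀ z ∈ bad, r ≤ lbDist y z) :
    x ∈ regionRel W bad r i := by
  by_contra hx
  obtain ⟨y, hy, hd⟩ := exists_seed_near_of_not_mem_regionRel i hx
  have hy0 : y ∈ regionRel W bad r 0 := mem_regionRel_zero.mpr (h y hd)
  exact (mem_regionRel.mp hy0) hy

/-- With no large field and the whole lattice as window every `Λ_i^{(k)}` is the whole torus. [cite: Balaban1982Higgs2, (2.8) p.558] -/
theorem regionRel_eq_univ (r : ℝ) (i : ℕ) :
    regionRel (Finset.univ : Finset (HiggsLattice.Site P k)) (∅ : Set (HiggsLattice.Site P k)) r i = Finset.univ := by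
  rw [regionRel_univ, region_eq_univ_of_bad_empty]

end Rel

/-! ## §4 p. 566: the general-level «admissibility» condition holds for the construction

*"In general Λ₀^{(j+1)} ⊂ Λ₇^{(j)′}, and either Λ₀^{(j+1)} is a maximal set composed of big blocks and satisfying this
inclusion, or the set Λ₀^{(j+1)c} ∩ Λ₇^{(j)′} has at least one point whose distance from Λ₀^{(j+1)} is bigger than
r(L^{j+1}ε)"* — for `Λ₀ = regionRel W bad r 0` with the large-field points inside the window (p. 570: the restrictions
producing them are *"considered on the set Λ₇^{(k−1)′}"*): `Λ₀ ⊆ W` and `Λ₀` is a union of large blocks (§3); if there is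
no large-field point near a large block of the window then `Λ₀ = inLB W`, the maximal one; otherwise a large-field point
`z ∈ W` lies in `Λ₀ᶜ` at distance `≥ r` from every point of `Λ₀` (as in gen-8's `admissible_zero`, `≥` is what the
construction yields). -/

section Admissible

variable {W : Finset (HiggsLattice.Site P k)} {bad : Set (HiggsLattice.Site P k)} {r : ℝ}

/-- If every large block inside the window is at distance `≥ r` from the large fields, `Λ₀^{(k)}` is the maximal union of
large blocks inside the window. [cite: Balaban1982Higgs2, (2.43) p.566] -/
theorem regionRel_zero_eq_inLB_of_far (h : ∀ x ∈ inLB W, ∀ z ∈ bad, r ≤ lbDist x z) : regionRel W bad r 0 = inLB W := by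
  ext x
  rw [mem_regionRel_zero, mem_inLB]
  exact ⟨fun hx => hx.1, fun hx => ⟨hx, h x (mem_inLB.mpr hx)⟩⟩

/-- In particular with no large field at all. [cite: Balaban1982Higgs2, (2.43) p.566] -/
theorem regionRel_zero_eq_inLB_of_forall_not_bad (h : ∀ z : HiggsLattice.Site P k, z ∉ bad) : regionRel W bad r 0 = inLB W :=
  regionRel_zero_eq_inLB_of_far fun _ _ z hz => absurd hz (h z)

/-- **p. 566, the general-level admissibility condition, PROVED for the construction of p. 570** (large-field points inside
the window, `r > 0`): either `Λ₀^{(k)}` is the maximal union of large blocks contained in the window, or `Λ₀^{(k)c} ∩ W`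
contains a point (a large-field point) at distance `≥ r` from every point of `Λ₀^{(k)}`. [cite: Balaban1982Higgs2, (2.43) p.566] -/
theorem admissible_rel (hr : 0 < r) (hbad : bad ⊆ ↑W) :
    regionRel W bad r 0 = inLB W ∨
      ∃ z ∈ W, z ∉ regionRel W bad r 0 ∧ ∀ x ∈ regionRel W bad r 0, r ≤ (HiggsLattice.Site.tdist z x : ℝ) := by
  by_cases h : ∃ z : HiggsLattice.Site P k, z ∈ bad
  · obtain ⟨z, hz⟩ := h
    exact Or.inr ⟨z, Finset.mem_coe.mp (hbad hz), not_mem_regionRel_of_bad hr 0 hz, fun x hx => sep_bad_rel' hr.le 0 hx hz⟩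
  · exact Or.inl (regionRel_zero_eq_inLB_of_forall_not_bad fun z hz => h ⟨z, hz⟩)

/-- The three printed clauses together: `Λ₀^{(k)}` is a union of large blocks, `Λ₀^{(k)} ⊆ W`, and the dichotomy of
`admissible_rel`. [cite: Balaban1982Higgs2, (2.43) p.566] -/
theorem admissible_rel_full (hr : 0 < r) (hbad : bad ⊆ ↑W) :
    IsUnionOfLargeBlocks (regionRel W bad r 0) ∧ regionRel W bad r 0 ⊆ W ∧
      (regionRel W bad r 0 = inLB W ∨
        ∃ z ∈ W, z ∉ regionRel W bad r 0 ∧ ∀ x ∈ regionRel W bad r 0, r ≤ (HiggsLattice.Site.tdist z x : ℝ)) :=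
  ⟨regionRel_isUnionOfLargeBlocks W bad r 0, regionRel_subset_window hr.le 0, admissible_rel hr hbad⟩

/-- The same with the distance read as `dist(z, Λ₀^{(k)}) = min_{x ∈ Λ₀^{(k)}} |z − x|` (r14's `distC` applied to the
complement): `Λ₀^{(k)} = inLB W`, or `Λ₀^{(k)} = ∅` (distance undefined, `distC = 0`), or some `z ∈ Λ₀^{(k)c} ∩ W` has
`dist(z, Λ₀^{(k)}) ≥ r`. [cite: Balaban1982Higgs2, (2.43) p.566] -/
theorem admissible_rel_distC (hr : 0 < r) (hbad : bad ⊆ ↑W) :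
    regionRel W bad r 0 = inLB W ∨ regionRel W bad r 0 = ∅ ∨
      ∃ z ∈ W, z ∉ regionRel W bad r 0 ∧ r ≤ distC (regionRel W bad r 0)ᶜ z := by
  rcases admissible_rel hr hbad with h | ⟨z, hzW, hz, hfar⟩
  · exact Or.inl h
  · by_cases hne : (regionRel W bad r 0).Nonempty
    · refine Or.inr (Or.inr ⟨z, hzW, hz, ?_⟩)
      have hne' : ((regionRel W bad r 0)ᶜᶜ).Nonempty := by rwa [compl_compl]
      unfold distC
      rw [dif_pos hne', Finset.le_inf'_iff]
      intro x hx
      rw [compl_compl] at hx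
      exact hfar x hx
    · exact Or.inr (Or.inl (Finset.not_nonempty_iff_eq_empty.mp hne))

end Admissible

end Literature.MathematicalPhysics.QuantumFieldTheory.Balaban1983to89.B2Eq255RegionsWindow
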